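import Mathlib
import Summits.NavierStokesRegularity.NavierStokesRegularity.Theorems.FilamentSkeletonRssClause13ModelFarPointwiseWeighted
import Summits.NavierStokesRegularity.NavierStokesRegularity.Theorems.FilamentSkeletonRssClause13PieceSup

/-!
# Clause 13-J/13-R, brick m3-w (MODEL, WEIGHTED POINTWISE — THE CLAUSE'S SHAPE): `‖Y(τ)‖ ≤ 2(1+|τ−c|/ℓ)^p·[(C_N + K(β₀K)Gε_X(1+‖k‖₁))N(Y) + K(β₀K)((1+‖k‖₁)S_L + ΛS_T)]`

Route `FilamentSkeletonRss`, ∃-side clause 13 (`Clause13RNearStraightL`, stmt-NavierStokesRegularity-23612; typing-agnostic).  Design of record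
rev 80–82 (m3; tenure R-m3b-2/3) and lane memo `DESIGN-28296-model-Linfty-g18.md` §3.  The flat statement (`model_pointwise`,
`…Clause13ModelPointwise`) sups over the ball and pays `(R/ℓ)^p`; here the bootstrap norm is the WEIGHTED sup `S^ω = sup_τ ‖Y(τ)‖/ω(τ)`,
`ω(τ) = (1+|τ−c|/ℓ)^p` (`0 ≤ p ≤ 2`: the clause's `b_* ≈ 1 + 2β₀` exceeds `1`), attained by continuity and compact support.  With the weighted far part
(`model_far_pointwise_weighted_right/left`, `…Clause13ModelFarPointwiseWeighted`) and the near part by Agmon (`norm_piece_le_sqrt_mul_l2`, p711085):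
★★ `model_pointwise_weighted` — for `Y ∈ C¹_c` supported in `[c−R, c+R]` (`0 < ℓ ≤ R`), under the two-sided waist structure (as in
`model_pointwise`) and the Γ-UNIFORM absorption condition `4K(β₀K)·c_k^{ℓ,2} ≤ ½`:  for EVERY `τ`,
  `‖Y(τ)‖ ≤ 2·(1+|τ−c|/ℓ)^p·[(C_N + K(β₀K)·G·ε_X(1+‖k‖₁))·N(Y) + K(β₀K)·((1+‖k‖₁)·S_L + Λ·S_T)]`, `C_N = √(‖k‖₁‖k′‖₁)` — no `(R/ℓ)^p`.
This is the model 13-J∘ in the clause's own shape (`b = p ≤ 2`, `a = 0`) in MODEL currency (`N(Y) ≤ A·N(𝓛Y)` by `model_l2_estimate_scaled`; `S_L`,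
`N(𝓛Y)` over ℝ, exterior tail included).  HONEST LABEL: the exchange (I)/(II)/(III) to the clause's in-ball pointwise defect is the booked
waist-localisation design point and is NOT done here.
Lane ns-filament-19175-p1 g18; `--supports stmt-NavierStokesRegularity-23612 --as helper`.
HONEST FRAMING: an a-priori weighted sup estimate for an explicit 1-D model operator attached to a HYPOTHETICAL filament skeleton on the NEGATIVE side
of a MODEL route; nothing here bears on Navier–Stokes regularity or blow-up; 23610/23612 stay OPEN.
-/

noncomputable section

open MeasureTheory Real Complex Filter Set
open scoped ComplexConjugate Topology

namespace Summit.NavierStokesRegularity.NavierStokesRegularity.Theorems.MatchedKernel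
set_option linter.dupNamespace false

/-! ## §3 The weighted bootstrap on the ball -/

/-- ★★ **THE MODEL IN WEIGHTED `L∞` (THE CLAUSE'S SHAPE).**  All hypotheses of `model_far_pointwise_weighted_right` (zone `[c, c+ℓ] ∪ [c+ℓ, c+R]`)
and `…_left` (zone `[c−R, c−ℓ] ∪ [c−ℓ, c]`) with `0 < ℓ ≤ R`, `k′ ∈ L¹`, `Y` supported in `[c−R, c+R]`, `S_T ≥ ‖P_T‖` on the ball, and the absorption
condition `4K(β₀K)·c_k^{ℓ,2} ≤ ½`.  Then for EVERY `τ`: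
`‖Y(τ)‖ ≤ 2·(1+|τ−c|/ℓ)^p·[(C_N + K(β₀K)·G·ε_X(1+‖k‖₁))·N(Y) + K(β₀K)·((1+‖k‖₁)·S_L + Λ·S_T)]`. [folklore] -/
theorem model_pointwise_weighted {q G X : ℝ} (hq : 0 < q) (hG : 0 < G) (hX : 0 < X)
    {k k' : ℝ → ℝ} (hk : ∀ t, HasDerivAt k (k' t) t) (hk'c : Continuous k')
    (hki : Integrable k) (hk'i : Integrable k') (hk1 : Integrable fun t => t * k t) (hk2 : Integrable fun t => t ^ 2 * k t)
    (hk3 : Integrable fun t => t ^ 3 * k t) (hk'2 : Integrable fun t => t ^ 2 * k' t) (hk'3 : Integrable fun t => t ^ 3 * k' t)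
    (hk'4 : Integrable fun t => t ^ 4 * k' t) {Mk : ℝ} (hkM : ∀ t, |k t| ≤ Mk)
    {χ : ℝ → ℂ} (hkχ : ∀ z : ℝ, ∫ t : ℝ, ((k t : ℝ) : ℂ) * cexp (I * z * t) = χ z) (hfar : ∀ z : ℝ, χ z ≠ 1 → X ≤ |z| * √q)
    {Y : ℝ → ℂ} (hY : ContDiff ℝ 1 Y) (hYs : HasCompactSupport Y) {c R ℓ : ℝ} (hℓ : 0 < ℓ) (hℓR : ℓ ≤ R)
    (hYR : ∀ x, x ∉ Set.Icc (c - R) (c + R) → Y x = 0)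
    {w : ℝ → ℝ} (hw : Differentiable ℝ w) (hw2 : Differentiable ℝ (deriv w)) {Λ Λ₂ : ℝ} (hΛ : ∀ t, |deriv w t| ≤ Λ)
    (hΛ₂ : ∀ t, |deriv (deriv w) t| ≤ Λ₂) {w₁ : ℝ} (hw₁ : 0 < w₁)
    (hwc : w c = 0) (hwpos : ∀ τ ∈ Icc c (c + R), c < τ → 0 < w τ) (hwneg : ∀ τ ∈ Icc (c - R) c, τ < c → w τ < 0)
    (hww₁ : ∀ τ ∈ Icc (c + ℓ) (c + R), w₁ * (τ - c) ≤ w τ) (hww₁' : ∀ τ ∈ Icc (c - R) (c - ℓ), w₁ * (c - τ) ≤ -w τ)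
    {β₁ β₂ β₂' : ℝ → ℂ} (hβ₁c : Continuous β₁) (hβ₂ : ∀ τ, HasDerivAt β₂ (β₂' τ) τ) {b₁ b₂ L₁ L₂ : ℝ}
    (hb₁ : ∀ τ, ‖β₁ τ‖ ≤ b₁) (hb₂ : ∀ τ, ‖β₂ τ‖ ≤ b₂) (hL₁ : ∀ x y, ‖β₁ y - β₁ x‖ ≤ L₁ * |y - x|)
    (hL₂ : ∀ x y, ‖β₂ y - β₂ x‖ ≤ L₂ * |y - x|) (hsmall : b₂ ≤ 2 * G / q)
    {β₀ p : ℝ} (hβ₀ : 0 < β₀) (hp0 : 0 ≤ p) (hp2 : p ≤ 2)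
    (hgain : ∀ τ ∈ Icc c (c + ℓ), β₀ ≤ -(β₁ τ).re
      - (b₂ / (2 * (2 * G / q))) / (1 - b₂ / (2 * (2 * G / q))) * (2 * |(β₁ τ).im| + b₂ / (2 * (2 * G / q)) * ‖β₂ τ‖)
      - (w τ * ‖β₂' τ‖ / (2 * (2 * G / q))) / (1 - b₂ / (2 * (2 * G / q))))
    (hgain' : ∀ τ ∈ Icc (c - ℓ) c, β₀ ≤ -(β₁ τ).re
      - (b₂ / (2 * (2 * G / q))) / (1 - b₂ / (2 * (2 * G / q))) * (2 * |(β₁ τ).im| + b₂ / (2 * (2 * G / q)) * ‖β₂ τ‖)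
      - (-w τ * ‖β₂' τ‖ / (2 * (2 * G / q))) / (1 - b₂ / (2 * (2 * G / q))))
    (hstag : β₀ ≤ 2 * G / q - ‖β₁ c‖ - ‖β₂ c‖)
    (hgrow : ∀ τ ∈ Icc (c + ℓ) (c + R), (β₁ τ).re + β₀
      + (b₂ / (2 * (2 * G / q))) / (1 - b₂ / (2 * (2 * G / q))) * (2 * |(β₁ τ).im| + b₂ / (2 * (2 * G / q)) * ‖β₂ τ‖)
      + (w τ * ‖β₂' τ‖ / (2 * (2 * G / q))) / (1 - b₂ / (2 * (2 * G / q))) ≤ p * w₁)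
    (hgrow' : ∀ τ ∈ Icc (c - R) (c - ℓ), (β₁ τ).re + β₀
      + (b₂ / (2 * (2 * G / q))) / (1 - b₂ / (2 * (2 * G / q))) * (2 * |(β₁ τ).im| + b₂ / (2 * (2 * G / q)) * ‖β₂ τ‖)
      + (-w τ * ‖β₂' τ‖ / (2 * (2 * G / q))) / (1 - b₂ / (2 * (2 * G / q))) ≤ p * w₁)
    {SL ST : ℝ}
    (hSL : ∀ y : ℝ, ‖I * (G : ℂ) * ((2 / q : ℂ) * Y y
          - ∫ σ : ℝ, ((((2 * q - (y - σ) ^ 2) * (((y - σ) ^ 2 + q) ^ (5 / 2 : ℝ))⁻¹ : ℝ)) : ℂ) * Y σ)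
        - ((w y : ℝ) : ℂ) * deriv Y y + β₁ y * Y y + β₂ y * conj (Y y)‖ ≤ SL)
    (hST : ∀ x ∈ Icc (c - R) (c + R), ‖∫ y : ℝ, (((x - y) * k' (x - y) + k (x - y) : ℝ) : ℂ) * Y y‖ ≤ ST)
    -- absorption condition `4K(β₀K)·c_k^{ℓ,2} ≤ ½`
    (habs : 4 * ((((1 + b₂ / (2 * (2 * G / q))) / β₀) / (1 - b₂ / (2 * (2 * G / q))))
        * (β₀ * (((1 + b₂ / (2 * (2 * G / q))) / β₀) / (1 - b₂ / (2 * (2 * G / q))))))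
        * (Λ₂ * (((∫ t, t ^ 2 * |k' t|) + (∫ t, |t| * |k t|))
              + 2 * ((∫ t, |t| ^ 3 * |k' t|) + (∫ t, t ^ 2 * |k t|)) / ℓ
              + ((∫ t, t ^ 4 * |k' t|) + (∫ t, |t| ^ 3 * |k t|)) / ℓ ^ 2)
            + (L₁ + L₂) * ((∫ t, |t| * |k t|) + 2 * (∫ t, t ^ 2 * |k t|) / ℓ + (∫ t, |t| ^ 3 * |k t|) / ℓ ^ 2)) ≤ 1 / 2) :
    ∀ τ : ℝ, ‖Y τ‖ ≤ 2 * (1 + |τ - c| / ℓ) ^ p *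
        ((Real.sqrt ((∫ t, |k t|) * ∫ t, |k' t|)
            + (((1 + b₂ / (2 * (2 * G / q))) / β₀) / (1 - b₂ / (2 * (2 * G / q))))
              * (β₀ * (((1 + b₂ / (2 * (2 * G / q))) / β₀) / (1 - b₂ / (2 * (2 * G / q)))))
              * (G * (10 / (q * Real.sqrt (π * √q)) * Real.exp (-(X / 2)) * (1 + ∫ t, |k t|))))
            * (∫ x : ℝ, ‖Y x‖ ^ 2) ^ (1 / 2 : ℝ)
          + (((1 + b₂ / (2 * (2 * G / q))) / β₀) / (1 - b₂ / (2 * (2 * G / q))))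
              * (β₀ * (((1 + b₂ / (2 * (2 * G / q))) / β₀) / (1 - b₂ / (2 * (2 * G / q)))))
            * ((1 + ∫ t, |k t|) * SL + Λ * ST)) := by
  have hkc : Continuous k := continuous_iff_continuousAt.2 fun t => (hk t).continuousAt
  have hYc := hY.continuous
  have hGq : 0 < 2 * G / q := by positivity
  have hb20 : 0 ≤ b₂ := (norm_nonneg _).trans (hb₂ 0)
  have hk2' : b₂ / (2 * (2 * G / q)) ≤ 1 / 2 := by rw [div_le_iff₀ (by positivity)]; linarith
  have h1k : 0 < 1 - b₂ / (2 * (2 * G / q)) := by linarith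
  have hΛ0 : 0 ≤ Λ := (abs_nonneg _).trans (hΛ 0)
  -- abbreviations
  set K : ℝ := ((1 + b₂ / (2 * (2 * G / q))) / β₀) / (1 - b₂ / (2 * (2 * G / q))) with hKdef
  have hK0 : 0 < K := by positivity
  set CH : ℝ := K * (β₀ * K) with hCHdef
  have hCH0 : 0 < CH := by positivity
  set CN : ℝ := Real.sqrt ((∫ t, |k t|) * ∫ t, |k' t|) with hCNdef
  set NY : ℝ := (∫ x : ℝ, ‖Y x‖ ^ 2) ^ (1 / 2 : ℝ) with hNYdef
  have hNY0 : 0 ≤ NY := by positivity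
  set EG : ℝ := G * (10 / (q * Real.sqrt (π * √q)) * Real.exp (-(X / 2)) * (1 + ∫ t, |k t|)) with hEGdef
  have hkint0 : 0 ≤ ∫ t, |k t| := integral_nonneg fun t => abs_nonneg _
  have hEG0 : 0 ≤ EG := by positivity
  set ck : ℝ := Λ₂ * (((∫ t, t ^ 2 * |k' t|) + (∫ t, |t| * |k t|))
              + 2 * ((∫ t, |t| ^ 3 * |k' t|) + (∫ t, t ^ 2 * |k t|)) / ℓ
              + ((∫ t, t ^ 4 * |k' t|) + (∫ t, |t| ^ 3 * |k t|)) / ℓ ^ 2)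
            + (L₁ + L₂) * ((∫ t, |t| * |k t|) + 2 * (∫ t, t ^ 2 * |k t|) / ℓ + (∫ t, |t| ^ 3 * |k t|) / ℓ ^ 2) with hckdef
  set ω : ℝ → ℝ := fun τ => (1 + |τ - c| / ℓ) ^ p with hωdef
  have hω1 : ∀ τ, 1 ≤ ω τ := fun τ => (weight_facts_ball (c := c) hℓ hp0 hp2 τ).1
  have hωpos : ∀ τ, 0 < ω τ := fun τ => lt_of_lt_of_le one_pos (hω1 τ)
  have hωc : Continuous ω :=
    (continuous_const.add (((continuous_id.sub continuous_const).abs).div_const ℓ)).rpow_const fun _ => Or.inr hp0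
  -- the weighted maximum of `‖Y‖/ω`
  have hgc : Continuous fun τ => ‖Y τ‖ * (ω τ)⁻¹ := hYc.norm.mul (hωc.inv₀ fun τ => (hωpos τ).ne')
  have hgs : HasCompactSupport fun τ => ‖Y τ‖ * (ω τ)⁻¹ := hYs.norm.mul_right
  obtain ⟨τ₀, hτ₀⟩ := hgc.exists_forall_ge_of_hasCompactSupport hgs
  set S : ℝ := ‖Y τ₀‖ * (ω τ₀)⁻¹ with hSdef
  have hS0 : 0 ≤ S := mul_nonneg (norm_nonneg _) (inv_nonneg.2 (hωpos τ₀).le)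
  have hSY : ∀ y : ℝ, ‖Y y‖ ≤ S * (1 + |y - c| / ℓ) ^ p := by
    intro y
    have h := hτ₀ y
    have hωy := hωpos y
    calc ‖Y y‖ = ‖Y y‖ * (ω y)⁻¹ * ω y := by field_simp
      _ ≤ S * ω y := mul_le_mul_of_nonneg_right h hωy.le
  -- the far part on both sides against the weighted sup
  have hright := model_far_pointwise_weighted_right hq hG hX hk hk'c hki hk1 hk2 hk3 hk'2 hk'3 hk'4 hkM hkχ hfar hY hYs hw hw2 hΛ hΛ₂ (ℓ := ℓ)
    (b := c + R) hℓ (by linarith) hw₁ hwc hwpos hww₁ hβ₁c hβ₂ hb₁ hb₂ hL₁ hL₂ hsmall hβ₀ hp0 hp2 hgain hstag hgrow hS0 hSL hSY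
    (fun x hx => hST x ⟨by linarith [hx.1], hx.2⟩)
  have hleft := model_far_pointwise_weighted_left hq hG hX hk hk'c hki hk1 hk2 hk3 hk'2 hk'3 hk'4 hkM hkχ hfar hY hYs hw hw2 hΛ hΛ₂ (ℓ := ℓ)
    (b := c - R) hℓ (by linarith) hw₁ hwc hwneg hww₁' hβ₁c hβ₂ hb₁ hb₂ hL₁ hL₂ hsmall hβ₀ hp0 hp2 hgain' hstag hgrow' hS0 hSL hSY
    (fun x hx => hST x ⟨hx.1, by linarith [hx.2]⟩)
  -- `‖Y_H(τ)‖ ≤ CH (M₀ + 2 ck S) ω(τ)` on the whole ball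
  set M0 : ℝ := EG * NY + ((1 + ∫ t, |k t|) * SL + Λ * ST) with hM0def
  have hfarball : ∀ τ ∈ Icc (c - R) (c + R), ‖Y τ - ∫ y : ℝ, ((k (τ - y) : ℝ) : ℂ) * Y y‖ ≤ CH * (M0 + 4 * ck * S) * ω τ := by
    intro τ hτ
    rcases le_or_gt τ c with hτc | hτc
    · have h := hleft τ ⟨hτ.1, hτc⟩
      simpa only [hCHdef, hM0def, hEGdef, hckdef, hKdef, hNYdef, hωdef, mul_assoc] using h
    · have h := hright τ ⟨hτc.le, hτ.2⟩
      simpa only [hCHdef, hM0def, hEGdef, hckdef, hKdef, hNYdef, hωdef, mul_assoc] using h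
  -- the near part everywhere
  have hnear : ∀ τ : ℝ, ‖∫ y : ℝ, ((k (τ - y) : ℝ) : ℂ) * Y y‖ ≤ CN * NY :=
    fun τ => norm_piece_le_sqrt_mul_l2 hk hk'c hki hk'i hY hYs τ
  have hCN0 : 0 ≤ CN := Real.sqrt_nonneg _
  -- on the ball: `‖Y τ‖/ω(τ) ≤ CN·NY + CH·M0 + 4 CH ck S`
  have hSLnn : 0 ≤ SL := (norm_nonneg _).trans (hSL 0)
  have hSTnn : 0 ≤ ST := (norm_nonneg _).trans (hST c ⟨by linarith, by linarith⟩)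
  have hM00 : 0 ≤ M0 := by
    simp only [hM0def]
    have h2 : 0 ≤ (1 + ∫ t, |k t|) * SL := mul_nonneg (by linarith) hSLnn
    have h3 : 0 ≤ Λ * ST := mul_nonneg hΛ0 hSTnn
    have h4 : 0 ≤ EG * NY := mul_nonneg hEG0 hNY0
    linarith
  set A : ℝ := CN * NY + CH * M0 with hAdef
  have hA0 : 0 ≤ A := by positivity
  have hball : ∀ τ ∈ Icc (c - R) (c + R), ‖Y τ‖ * (ω τ)⁻¹ ≤ A + 4 * CH * ck * S := by
    intro τ hτ
    have hωτ := hωpos τ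
    have h1 : ‖Y τ‖ ≤ CN * NY + CH * (M0 + 4 * ck * S) * ω τ := by
      calc ‖Y τ‖ = ‖(Y τ - ∫ y : ℝ, ((k (τ - y) : ℝ) : ℂ) * Y y) + ∫ y : ℝ, ((k (τ - y) : ℝ) : ℂ) * Y y‖ := by rw [sub_add_cancel]
        _ ≤ ‖Y τ - ∫ y : ℝ, ((k (τ - y) : ℝ) : ℂ) * Y y‖ + ‖∫ y : ℝ, ((k (τ - y) : ℝ) : ℂ) * Y y‖ := norm_add_le _ _
        _ ≤ CH * (M0 + 4 * ck * S) * ω τ + CN * NY := add_le_add (hfarball τ hτ) (hnear τ)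
        _ = CN * NY + CH * (M0 + 4 * ck * S) * ω τ := by ring
    have h2 : CN * NY ≤ CN * NY * ω τ := le_mul_of_one_le_right (mul_nonneg hCN0 hNY0) (hω1 τ)
    have h3 : ‖Y τ‖ ≤ (A + 4 * CH * ck * S) * ω τ := by
      calc ‖Y τ‖ ≤ CN * NY + CH * (M0 + 4 * ck * S) * ω τ := h1
        _ ≤ CN * NY * ω τ + CH * (M0 + 4 * ck * S) * ω τ := by linarith
        _ = (A + 4 * CH * ck * S) * ω τ := by simp only [hAdef]; ring
    rw [mul_inv_le_iff₀ hωτ]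
    linarith [h3]
  -- absorption at the weighted maximum
  have hS : S ≤ 2 * A := by
    by_cases hτ₀b : τ₀ ∈ Icc (c - R) (c + R)
    · have h := hball τ₀ hτ₀b
      have hck : 4 * CH * ck * S ≤ 1 / 2 * S := by
        have := mul_le_mul_of_nonneg_right habs hS0
        have e : 4 * (K * (β₀ * K)) * ck * S = 4 * CH * ck * S := by simp only [hCHdef]
        linarith [e]
      have : S ≤ A + 1 / 2 * S := h.trans (by linarith)
      linarith
    · have : S = 0 := by simp only [hSdef, hYR τ₀ hτ₀b, norm_zero, zero_mul]
      linarith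
  intro τ
  have hωτ := hωpos τ
  have h1 : ‖Y τ‖ ≤ S * ω τ := hSY τ
  have h2 : S * ω τ ≤ 2 * A * ω τ := mul_le_mul_of_nonneg_right hS hωτ.le
  refine (h1.trans h2).trans (le_of_eq ?_)
  simp only [hAdef, hCHdef, hCNdef, hEGdef, hKdef, hNYdef, hM0def, hωdef]
  ring

/-! ## §4 The absorption condition from an explicit, Γ-free smallness of the multiplier variation -/

/-- ★ **`model_pointwise_weighted` WITH THE ABSORPTION CONDITION DISCHARGED.**  If the damped half-width has `ℓ ≥ 1` and
`72·(Λ₂ + L₁ + L₂)·Mom(k) ≤ β₀`, where `Mom(k) = (‖t²k′‖₁+‖tk‖₁) + 2(‖t³k′‖₁+‖t²k‖₁) + (‖t⁴k′‖₁+‖t³k‖₁) + ‖tk‖₁ + 2‖t²k‖₁ + ‖t³k‖₁`, then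
(`k₂ = b₂q/(4G) ≤ ½` ⟹ `K ≤ 3/β₀`, `β₀K ≤ 3`) the absorption condition `4K(β₀K)c_k^{ℓ,2} ≤ ½` holds and the conclusion of
`model_pointwise_weighted` follows.  In the clause scaling `Λ₂, L₁, L₂ ≲ Γ^{-1/2}` while `Mom(k)` (moments of the near kernel) and `β₀` are
Γ-free: the condition holds for `Γ ≥ Γ₀`. [folklore] -/
theorem model_pointwise_weighted_small {q G X : ℝ} (hq : 0 < q) (hG : 0 < G) (hX : 0 < X)
    {k k' : ℝ → ℝ} (hk : ∀ t, HasDerivAt k (k' t) t) (hk'c : Continuous k')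
    (hki : Integrable k) (hk'i : Integrable k') (hk1 : Integrable fun t => t * k t) (hk2 : Integrable fun t => t ^ 2 * k t)
    (hk3 : Integrable fun t => t ^ 3 * k t) (hk'2 : Integrable fun t => t ^ 2 * k' t) (hk'3 : Integrable fun t => t ^ 3 * k' t)
    (hk'4 : Integrable fun t => t ^ 4 * k' t) {Mk : ℝ} (hkM : ∀ t, |k t| ≤ Mk)
    {χ : ℝ → ℂ} (hkχ : ∀ z : ℝ, ∫ t : ℝ, ((k t : ℝ) : ℂ) * cexp (I * z * t) = χ z) (hfar : ∀ z : ℝ, χ z ≠ 1 → X ≤ |z| * √q)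
    {Y : ℝ → ℂ} (hY : ContDiff ℝ 1 Y) (hYs : HasCompactSupport Y) {c R ℓ : ℝ} (hℓ : 0 < ℓ) (hℓR : ℓ ≤ R)
    (hYR : ∀ x, x ∉ Set.Icc (c - R) (c + R) → Y x = 0)
    {w : ℝ → ℝ} (hw : Differentiable ℝ w) (hw2 : Differentiable ℝ (deriv w)) {Λ Λ₂ : ℝ} (hΛ : ∀ t, |deriv w t| ≤ Λ)
    (hΛ₂ : ∀ t, |deriv (deriv w) t| ≤ Λ₂) {w₁ : ℝ} (hw₁ : 0 < w₁)
    (hwc : w c = 0) (hwpos : ∀ τ ∈ Icc c (c + R), c < τ → 0 < w τ) (hwneg : ∀ τ ∈ Icc (c - R) c, τ < c → w τ < 0)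
    (hww₁ : ∀ τ ∈ Icc (c + ℓ) (c + R), w₁ * (τ - c) ≤ w τ) (hww₁' : ∀ τ ∈ Icc (c - R) (c - ℓ), w₁ * (c - τ) ≤ -w τ)
    {β₁ β₂ β₂' : ℝ → ℂ} (hβ₁c : Continuous β₁) (hβ₂ : ∀ τ, HasDerivAt β₂ (β₂' τ) τ) {b₁ b₂ L₁ L₂ : ℝ}
    (hb₁ : ∀ τ, ‖β₁ τ‖ ≤ b₁) (hb₂ : ∀ τ, ‖β₂ τ‖ ≤ b₂) (hL₁ : ∀ x y, ‖β₁ y - β₁ x‖ ≤ L₁ * |y - x|)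
    (hL₂ : ∀ x y, ‖β₂ y - β₂ x‖ ≤ L₂ * |y - x|) (hsmall : b₂ ≤ 2 * G / q)
    {β₀ p : ℝ} (hβ₀ : 0 < β₀) (hp0 : 0 ≤ p) (hp2 : p ≤ 2)
    (hgain : ∀ τ ∈ Icc c (c + ℓ), β₀ ≤ -(β₁ τ).re
      - (b₂ / (2 * (2 * G / q))) / (1 - b₂ / (2 * (2 * G / q))) * (2 * |(β₁ τ).im| + b₂ / (2 * (2 * G / q)) * ‖β₂ τ‖)
      - (w τ * ‖β₂' τ‖ / (2 * (2 * G / q))) / (1 - b₂ / (2 * (2 * G / q))))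
    (hgain' : ∀ τ ∈ Icc (c - ℓ) c, β₀ ≤ -(β₁ τ).re
      - (b₂ / (2 * (2 * G / q))) / (1 - b₂ / (2 * (2 * G / q))) * (2 * |(β₁ τ).im| + b₂ / (2 * (2 * G / q)) * ‖β₂ τ‖)
      - (-w τ * ‖β₂' τ‖ / (2 * (2 * G / q))) / (1 - b₂ / (2 * (2 * G / q))))
    (hstag : β₀ ≤ 2 * G / q - ‖β₁ c‖ - ‖β₂ c‖)
    (hgrow : ∀ τ ∈ Icc (c + ℓ) (c + R), (β₁ τ).re + β₀
      + (b₂ / (2 * (2 * G / q))) / (1 - b₂ / (2 * (2 * G / q))) * (2 * |(β₁ τ).im| + b₂ / (2 * (2 * G / q)) * ‖β₂ τ‖)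
      + (w τ * ‖β₂' τ‖ / (2 * (2 * G / q))) / (1 - b₂ / (2 * (2 * G / q))) ≤ p * w₁)
    (hgrow' : ∀ τ ∈ Icc (c - R) (c - ℓ), (β₁ τ).re + β₀
      + (b₂ / (2 * (2 * G / q))) / (1 - b₂ / (2 * (2 * G / q))) * (2 * |(β₁ τ).im| + b₂ / (2 * (2 * G / q)) * ‖β₂ τ‖)
      + (-w τ * ‖β₂' τ‖ / (2 * (2 * G / q))) / (1 - b₂ / (2 * (2 * G / q))) ≤ p * w₁)
    {SL ST : ℝ}
    (hSL : ∀ y : ℝ, ‖I * (G : ℂ) * ((2 / q : ℂ) * Y y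
          - ∫ σ : ℝ, ((((2 * q - (y - σ) ^ 2) * (((y - σ) ^ 2 + q) ^ (5 / 2 : ℝ))⁻¹ : ℝ)) : ℂ) * Y σ)
        - ((w y : ℝ) : ℂ) * deriv Y y + β₁ y * Y y + β₂ y * conj (Y y)‖ ≤ SL)
    (hST : ∀ x ∈ Icc (c - R) (c + R), ‖∫ y : ℝ, (((x - y) * k' (x - y) + k (x - y) : ℝ) : ℂ) * Y y‖ ≤ ST)
    -- explicit Γ-free smallness replacing the absorption condition: `ℓ ≥ 1` and `72·(Λ₂ + L₁ + L₂)·Mom(k) ≤ β₀`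
    (hℓ1 : 1 ≤ ℓ)
    (hsm : 72 * ((Λ₂ + (L₁ + L₂)) *
        ((((∫ t, t ^ 2 * |k' t|) + (∫ t, |t| * |k t|)) + 2 * ((∫ t, |t| ^ 3 * |k' t|) + (∫ t, t ^ 2 * |k t|))
            + ((∫ t, t ^ 4 * |k' t|) + (∫ t, |t| ^ 3 * |k t|)))
          + ((∫ t, |t| * |k t|) + 2 * (∫ t, t ^ 2 * |k t|) + (∫ t, |t| ^ 3 * |k t|)))) ≤ β₀) :
    ∀ τ : ℝ, ‖Y τ‖ ≤ 2 * (1 + |τ - c| / ℓ) ^ p *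
        ((Real.sqrt ((∫ t, |k t|) * ∫ t, |k' t|)
            + (((1 + b₂ / (2 * (2 * G / q))) / β₀) / (1 - b₂ / (2 * (2 * G / q))))
              * (β₀ * (((1 + b₂ / (2 * (2 * G / q))) / β₀) / (1 - b₂ / (2 * (2 * G / q)))))
              * (G * (10 / (q * Real.sqrt (π * √q)) * Real.exp (-(X / 2)) * (1 + ∫ t, |k t|))))
            * (∫ x : ℝ, ‖Y x‖ ^ 2) ^ (1 / 2 : ℝ)
          + (((1 + b₂ / (2 * (2 * G / q))) / β₀) / (1 - b₂ / (2 * (2 * G / q))))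
              * (β₀ * (((1 + b₂ / (2 * (2 * G / q))) / β₀) / (1 - b₂ / (2 * (2 * G / q)))))
            * ((1 + ∫ t, |k t|) * SL + Λ * ST)) := by
  have hGq : 0 < 2 * G / q := by positivity
  have hb20 : 0 ≤ b₂ := (norm_nonneg _).trans (hb₂ 0)
  have hΛ20 : 0 ≤ Λ₂ := (abs_nonneg _).trans (hΛ₂ 0)
  have hL1 : 0 ≤ L₁ := by have := hL₁ 0 1; rw [sub_zero, abs_one, mul_one] at this; exact (norm_nonneg _).trans this
  have hL2 : 0 ≤ L₂ := by have := hL₂ 0 1; rw [sub_zero, abs_one, mul_one] at this; exact (norm_nonneg _).trans this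
  -- `k₂ ≤ ½` ⟹ `K ≤ 3/β₀`, `β₀K ≤ 3`
  set k₂ : ℝ := b₂ / (2 * (2 * G / q)) with hk₂
  have hk₂0 : 0 ≤ k₂ := by simp only [hk₂]; exact div_nonneg hb20 (by positivity)
  have hk₂1 : k₂ ≤ 1 / 2 := by simp only [hk₂]; rw [div_le_iff₀ (by positivity)]; linarith
  have h1k : 0 < 1 - k₂ := by linarith
  set K : ℝ := ((1 + k₂) / β₀) / (1 - k₂) with hKdef
  have hK0 : 0 < K := by simp only [hKdef]; exact div_pos (div_pos (by linarith) hβ₀) h1k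
  have hβ₀K : β₀ * K ≤ 3 := by
    simp only [hKdef]
    rw [show β₀ * ((1 + k₂) / β₀ / (1 - k₂)) = (1 + k₂) / (1 - k₂) by field_simp]
    rw [div_le_iff₀ h1k]; linarith
  have hK3 : K ≤ 3 / β₀ := by
    rw [le_div_iff₀ hβ₀]; linarith
  -- the moments and the flat bound of `c_k^{ℓ,2}` for `ℓ ≥ 1`
  have hI1 : 0 ≤ ∫ t, t ^ 2 * |k' t| := integral_nonneg fun t => by positivity
  have hI2 : 0 ≤ ∫ t, |t| * |k t| := integral_nonneg fun t => by positivity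
  have hI3 : 0 ≤ ∫ t, |t| ^ 3 * |k' t| := integral_nonneg fun t => by positivity
  have hI4 : 0 ≤ ∫ t, t ^ 2 * |k t| := integral_nonneg fun t => by positivity
  have hI5 : 0 ≤ ∫ t, t ^ 4 * |k' t| := integral_nonneg fun t => by positivity
  have hI6 : 0 ≤ ∫ t, |t| ^ 3 * |k t| := integral_nonneg fun t => by positivity
  set A1 : ℝ := (∫ t, t ^ 2 * |k' t|) + (∫ t, |t| * |k t|) with hA1
  set A2 : ℝ := (∫ t, |t| ^ 3 * |k' t|) + (∫ t, t ^ 2 * |k t|) with hA2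
  set A3 : ℝ := (∫ t, t ^ 4 * |k' t|) + (∫ t, |t| ^ 3 * |k t|) with hA3
  set B1 : ℝ := ∫ t, |t| * |k t| with hB1
  set B2 : ℝ := ∫ t, t ^ 2 * |k t| with hB2
  set B3 : ℝ := ∫ t, |t| ^ 3 * |k t| with hB3
  have hA10 : 0 ≤ A1 := add_nonneg hI1 hI2
  have hA20 : 0 ≤ A2 := add_nonneg hI3 hI4
  have hA30 : 0 ≤ A3 := add_nonneg hI5 hI6
  have hℓ2 : 1 ≤ ℓ ^ 2 := by nlinarith
  have hdiv1 : ∀ {x : ℝ}, 0 ≤ x → x / ℓ ≤ x := fun hx => div_le_self hx hℓ1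
  have hdiv2 : ∀ {x : ℝ}, 0 ≤ x → x / ℓ ^ 2 ≤ x := fun hx => div_le_self hx hℓ2
  set cℓ : ℝ := Λ₂ * (A1 + 2 * A2 / ℓ + A3 / ℓ ^ 2) + (L₁ + L₂) * (B1 + 2 * B2 / ℓ + B3 / ℓ ^ 2) with hcℓ
  set Mom : ℝ := (A1 + 2 * A2 + A3) + (B1 + 2 * B2 + B3) with hMom
  have hcle : cℓ ≤ (Λ₂ + (L₁ + L₂)) * Mom := by
    have h1 : A1 + 2 * A2 / ℓ + A3 / ℓ ^ 2 ≤ Mom := by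
      have d1 := hdiv1 hA20
      have d2 := hdiv2 hA30
      have hB : 0 ≤ B1 + 2 * B2 + B3 := add_nonneg (add_nonneg hI2 (mul_nonneg zero_le_two hI4)) hI6
      have e : A1 + 2 * A2 / ℓ + A3 / ℓ ^ 2 = A1 + 2 * (A2 / ℓ) + A3 / ℓ ^ 2 := by ring
      rw [e]; simp only [hMom]; linarith
    have h2 : B1 + 2 * B2 / ℓ + B3 / ℓ ^ 2 ≤ Mom := by
      have d1 := hdiv1 hI4
      have d2 := hdiv2 hI6
      have hA : 0 ≤ A1 + 2 * A2 + A3 := add_nonneg (add_nonneg hA10 (mul_nonneg zero_le_two hA20)) hA30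
      have e : B1 + 2 * B2 / ℓ + B3 / ℓ ^ 2 = B1 + 2 * (B2 / ℓ) + B3 / ℓ ^ 2 := by ring
      rw [e]; simp only [hMom]; linarith
    have hMom0 : 0 ≤ Mom := add_nonneg (add_nonneg (add_nonneg hA10 (mul_nonneg zero_le_two hA20)) hA30)
      (add_nonneg (add_nonneg hI2 (mul_nonneg zero_le_two hI4)) hI6)
    calc cℓ = Λ₂ * (A1 + 2 * A2 / ℓ + A3 / ℓ ^ 2) + (L₁ + L₂) * (B1 + 2 * B2 / ℓ + B3 / ℓ ^ 2) := rfl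
      _ ≤ Λ₂ * Mom + (L₁ + L₂) * Mom := add_le_add (mul_le_mul_of_nonneg_left h1 hΛ20) (mul_le_mul_of_nonneg_left h2 (add_nonneg hL1 hL2))
      _ = (Λ₂ + (L₁ + L₂)) * Mom := by ring
  have hℓ0 : 0 ≤ ℓ := hℓ.le
  have hcℓ0 : 0 ≤ cℓ := by
    simp only [hcℓ]
    apply add_nonneg
    · exact mul_nonneg hΛ20 (add_nonneg (add_nonneg hA10 (div_nonneg (mul_nonneg zero_le_two hA20) hℓ0)) (div_nonneg hA30 (sq_nonneg ℓ)))
    · exact mul_nonneg (add_nonneg hL1 hL2) (add_nonneg (add_nonneg hI2 (div_nonneg (mul_nonneg zero_le_two hI4) hℓ0)) (div_nonneg hI6 (sq_nonneg ℓ)))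
  -- the absorption condition
  have habs : 4 * (K * (β₀ * K)) * cℓ ≤ 1 / 2 := by
    have h1 : K * (β₀ * K) ≤ 3 / β₀ * 3 := mul_le_mul hK3 hβ₀K (mul_nonneg hβ₀.le hK0.le) (by positivity)
    have h2 : 4 * (K * (β₀ * K)) * cℓ ≤ 4 * (3 / β₀ * 3) * ((Λ₂ + (L₁ + L₂)) * Mom) :=
      mul_le_mul (mul_le_mul_of_nonneg_left h1 (by norm_num)) hcle hcℓ0 (by positivity)
    refine h2.trans ?_
    rw [show 4 * (3 / β₀ * 3) * ((Λ₂ + (L₁ + L₂)) * Mom) = (36 * ((Λ₂ + (L₁ + L₂)) * Mom)) / β₀ by field_simp; ring]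
    rw [div_le_iff₀ hβ₀]
    linarith
  exact model_pointwise_weighted hq hG hX hk hk'c hki hk'i hk1 hk2 hk3 hk'2 hk'3 hk'4 hkM hkχ hfar hY hYs hℓ hℓR hYR hw hw2 hΛ hΛ₂ hw₁
    hwc hwpos hwneg hww₁ hww₁' hβ₁c hβ₂ hb₁ hb₂ hL₁ hL₂ hsmall hβ₀ hp0 hp2 hgain hgain' hstag hgrow hgrow' hSL hST habs

end Summit.NavierStokesRegularity.NavierStokesRegularity.Theorems.MatchedKernel

end
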